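import Summits.Parity.GeneralizedHardyLittlewood.Theorems.LiouvilleMADEngineToGHLTuplesReach
import Summits.Parity.GeneralizedHardyLittlewood.Theorems.LeeYangFibresPrimeCellsRelativeHardyLittlewoodDictionary
import HarnessLib

/-!
# `EngineToGHL` (stmt-Parity-14995), line `tuple_ladder`: its open stubs are INSTANCES of the sloped ladder's

Route `LiouvilleMAD` (Parity / GeneralizedHardyLittlewood), crux `EngineToGHL` (stmt-Parity-14995), which is
kernel-equivalent with NO hypothesis to the shared crux `PairsToGHL` (stmt-Parity-9389)
(`Theorems.EngineToGHL.engineToGHL_iff_pairsToGHL`).  Two strategist lines run Bombieri's asymptotic sieve as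
an induction on the number of forms:

* `Cruxes/EngineToGHL/Lines/tuple_ladder.lean` (this crux; every theorem-grade stub landed by lead c5): UNIT-SLOPE
  tuples `n + h`, `h ∈ H ∋ 0`, base `PairsHL`; open registered stubs `stub_tupleLevel` (relative tuple
  Elliott–Halberstam), `stub_tupleAtoms` (one Liouville factor against the tuple weight), and the residual
  `stub_reachToDimOne : Reach → DimOne`;
* `Cruxes/PairsToGHL/Lines/sloped_ladder.lean` (sibling crux 9389): ALL fixed positive one-dimensional systems
  `aᵢ n + bᵢ`, base `t = 1` (a theorem); open conjecture-grade inputs `stub_slopedLevel`, `stub_slopedAtoms`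
  and the residual `stub_shiftLift : BoundedDickson → DimOne`.

This file certifies, in the kernel, that the sloped inputs SUBSUME the unit-slope inputs verbatim, so that one
set of conjecture-grade children serves both cruxes:

* `tupleLevel_of_slopedLevel` — the registered statement of `stub_slopedLevel` (9389) implies the registered
  statement of `stub_tupleLevel` (14995): instantiate at the translate system `ψⱼ(n) = n + hⱼ` of `H`
  (`hⱼ = H.equivFin⁻¹ j`; non-degenerate by `isNondegenerateSystem_shift`; slopes `1 > 0`, shifts `hⱼ ≥ 0`) and
  read the dictionary `∏ⱼ Λ(ψⱼ(n)) = ∏_{h ∈ H} Λ(n + h)`, `(gcd(ψⱼ(ρ), d) = 1 ∀ j) ↔ (ρ + h ⊥ d ∀ h ∈ H)`;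
* `tupleAtoms_of_slopedAtoms` — likewise `stub_slopedAtoms` (9389) ⇒ `stub_tupleAtoms` (14995), adjoining
  `ψ(n) = n + h` (`h ∉ H`, so the extended system is again a translate system with distinct shifts);
* `engineToGHL_of_slopedInputs` — hence `EngineToGHL` from the two sloped inputs and this line's residual
  `Reach → DimOne` (`engineToGHL_of_reachInputs`, lead c5);
* `engineToGHL_of_boundedDickson_of_shiftLift` — and `EngineToGHL` from the sloped ladder's OUTPUT
  (`BoundedDickson`, stmt-Parity-13151 verbatim) and its residual `BoundedDickson → DimOne` (`engineToGHL_of_dimOne`).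

No new definitions; statements are the registered stub texts verbatim. [folklore]
-/

namespace Summit.Parity.GeneralizedHardyLittlewood.Theorems.EngineToGHL.SlopedInputs

open Finset Literature.NumberTheory.Sieve
open scoped ArithmeticFunction.vonMangoldt
open Summit.Parity.GeneralizedHardyLittlewood.Theses
open Summit.Parity.GeneralizedHardyLittlewood.Cruxes.PrimeCellsRelative.Sketch (isNondegenerateSystem_shift)

/-! ### Dictionary for the translate system `ψⱼ(n) = n + hⱼ` -/

/-- `ψ(n) = n + c` for the unit-slope form with constant `c`, at the point `![n]`. [folklore] -/
theorem eval_shiftForm (c n : ℤ) : (⟨fun _ => (1 : ℤ), c⟩ : AffLinForm 1).eval ![n] = n + c := by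
  rw [DimOne.eval_eq]
  simp

/-- `Λ_ℤ(n + m) = Λ(n + m)` for natural `n, m`. [folklore] -/
theorem intVonMangoldt_natCast_add (n m : ℕ) : intVonMangoldt ((n : ℤ) + (m : ℤ)) = Λ (n + m) := by
  unfold intVonMangoldt
  rw [← Nat.cast_add, Int.toNat_natCast]

/-- `(n + m).toNat = n + m` for natural `n, m`. [folklore] -/
theorem toNat_natCast_add (n m : ℕ) : Int.toNat ((n : ℤ) + (m : ℤ)) = n + m := by
  rw [← Nat.cast_add, Int.toNat_natCast]

/-- `gcd_ℤ(ρ + m, d) = 1 ↔ ρ + m ⊥ d` for natural `ρ, m, d`. [folklore] -/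
theorem int_gcd_natCast_add_eq_one_iff (ρ m d : ℕ) :
    Int.gcd ((ρ : ℤ) + (m : ℤ)) d = 1 ↔ Nat.Coprime (ρ + m) d := by
  rw [← Nat.cast_add, Int.gcd_natCast_natCast, Nat.coprime_iff_gcd_eq_one]

/-- `∏ⱼ Λ(n + hⱼ) = ∏_{h ∈ H} Λ(n + h)` for the enumeration `hⱼ = H.equivFin⁻¹ j`. [folklore] -/
theorem prod_vonMangoldt_equivFin_symm (H : Finset ℕ) (n : ℕ) :
    ∏ j : Fin H.card, Λ (n + (H.equivFin.symm j : ℕ)) = ∏ h ∈ H, Λ (n + h) := by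
  rw [← Finset.prod_coe_sort H (fun h => Λ (n + h))]
  exact Fintype.prod_equiv H.equivFin.symm _ _ (fun _ => rfl)

/-- `(ρ + hⱼ ⊥ d ∀ j) ↔ (ρ + h ⊥ d ∀ h ∈ H)` for the enumeration `hⱼ = H.equivFin⁻¹ j`. [folklore] -/
theorem forall_coprime_equivFin_symm (H : Finset ℕ) (ρ d : ℕ) :
    (∀ j : Fin H.card, Nat.Coprime (ρ + (H.equivFin.symm j : ℕ)) d) ↔ ∀ h ∈ H, Nat.Coprime (ρ + h) d := by
  constructor
  · intro hj h hh
    simpa using hj (H.equivFin ⟨h, hh⟩)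
  · intro hh j
    exact hh _ (H.equivFin.symm j).2

/-- The enumeration `j ↦ (hⱼ : ℤ)` of `H ⊆ ℕ` is injective. [folklore] -/
theorem injective_equivFin_symm_cast (H : Finset ℕ) :
    Function.Injective (fun j : Fin H.card => ((H.equivFin.symm j : ℕ) : ℤ)) := by
  intro i j hij
  have h0 : ((H.equivFin.symm i : ℕ) : ℤ) = ((H.equivFin.symm j : ℕ) : ℤ) := hij
  have h : (H.equivFin.symm i : ℕ) = (H.equivFin.symm j : ℕ) := by exact_mod_cast h0
  exact H.equivFin.symm.injective (Subtype.ext h)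

/-- The translate system of `H` is non-degenerate (distinct shifts). [cite: GreenTao2010, Def. 1.1] -/
theorem isNondegenerateSystem_translate (H : Finset ℕ) :
    IsNondegenerateSystem
      (fun j : Fin H.card => (⟨fun _ => (1 : ℤ), ((H.equivFin.symm j : ℕ) : ℤ)⟩ : AffLinForm 1)) :=
  isNondegenerateSystem_shift _ (injective_equivFin_symm_cast H)

/-- Adjoining `ψ(n) = n + h` with `h ∉ H` to the translate system of `H` gives the translate system of the
tuple `(h, h₀, …)`, again with distinct shifts, hence non-degenerate. [cite: GreenTao2010, Def. 1.1] -/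
theorem isNondegenerateSystem_vecCons_translate (H : Finset ℕ) (h : ℕ) (hh : h ∉ H) :
    IsNondegenerateSystem (Matrix.vecCons (⟨fun _ => (1 : ℤ), (h : ℤ)⟩ : AffLinForm 1)
      (fun j : Fin H.card => (⟨fun _ => (1 : ℤ), ((H.equivFin.symm j : ℕ) : ℤ)⟩ : AffLinForm 1))) := by
  have hcons : Matrix.vecCons (⟨fun _ => (1 : ℤ), (h : ℤ)⟩ : AffLinForm 1)
      (fun j : Fin H.card => (⟨fun _ => (1 : ℤ), ((H.equivFin.symm j : ℕ) : ℤ)⟩ : AffLinForm 1)) =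
      fun j => (⟨fun _ => (1 : ℤ),
        (Fin.cons (h : ℤ) (fun j : Fin H.card => ((H.equivFin.symm j : ℕ) : ℤ)) : Fin (H.card + 1) → ℤ) j⟩ :
          AffLinForm 1) := by
    funext j
    refine Fin.cases ?_ (fun i => ?_) j
    · simp
    · simp
  rw [hcons]
  refine isNondegenerateSystem_shift _ (Fin.cons_injective_iff.mpr ⟨?_, injective_equivFin_symm_cast H⟩)
  rintro ⟨j, hj⟩
  have hj0 : ((H.equivFin.symm j : ℕ) : ℤ) = (h : ℤ) := hj
  have hj' : (H.equivFin.symm j : ℕ) = h := by exact_mod_cast hj0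
  exact hh (hj' ▸ (H.equivFin.symm j).2)

/-! ### The sloped inputs subsume the unit-slope inputs -/

/-- **`stub_slopedLevel` (crux 9389, line `sloped_ladder`) implies `stub_tupleLevel` (crux 14995, line
`tuple_ladder`), statements verbatim.** Instantiate the sloped relative level-of-distribution hypothesis at the
translate system `ψⱼ(n) = n + hⱼ` of `H` (`t = #H ≥ 2`, slopes `1`, shifts `hⱼ ≥ 0`, non-degenerate) and
translate the weight `∏ⱼ Λ_ℤ(ψⱼ(n)) = ∏_{h∈H} Λ(n+h)` and the admissible-class condition
`gcd(ρ + hⱼ, d) = 1 ∀ j ↔ ρ + h ⊥ d ∀ h ∈ H`. [folklore] -/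
theorem stub_tupleLevelOfSloped :
    (∀ t : ℕ, 1 ≤ t → ∀ Φ : Fin t → Literature.NumberTheory.Sieve.AffLinForm 1, Literature.NumberTheory.Sieve.IsNondegenerateSystem Φ → (∀ i, 0 < (Φ i).coeff 0 ∧ 0 ≤ (Φ i).const) → (∀ δ : ℝ, 0 < δ → ∀ B : ℝ, ∃ C : ℝ, ∀ N : ℕ, 2 ≤ N → ∀ y r : ℕ → ℕ, (∀ d, y d ≤ N) → (∑ d ∈ Finset.Icc 1 ⌊(N : ℝ) ^ (1 - δ)⌋₊, |(∑ n ∈ (Finset.Icc 1 (y d)).filter (fun n : ℕ => n ≡ r d [MOD d]), ∏ i, Literature.NumberTheory.Sieve.intVonMangoldt ((Φ i).eval ![(n : ℤ)])) - (if ∀ i, Int.gcd ((Φ i).eval ![(r d : ℤ)]) d = 1 then ((((Finset.range d).filter (fun ρ : ℕ => ∀ i, Int.gcd ((Φ i).eval ![(ρ : ℤ)]) d = 1)).card : ℝ))⁻¹ else 0) * ∑ n ∈ Finset.Icc 1 (y d), ∏ i, Literature.NumberTheory.Sieve.intVonMangoldt ((Φ i).eval ![(n : ℤ)])|) ≤ C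 * N / Real.log N ^ B)) →
    ∀ H : Finset ℕ, 0 ∈ H → 2 ≤ H.card → (∀ δ : ℝ, 0 < δ → ∀ B : ℝ, ∃ C : ℝ, ∀ N : ℕ, 2 ≤ N → ∀ y r : ℕ → ℕ, (∀ d, y d ≤ N) → (∑ d ∈ Finset.Icc 1 ⌊(N : ℝ) ^ (1 - δ)⌋₊, |(∑ n ∈ (Finset.Icc 1 (y d)).filter (fun n : ℕ => n ≡ r d [MOD d]), ∏ h ∈ H, ArithmeticFunction.vonMangoldt (n + h)) - (if ∀ h ∈ H, Nat.Coprime (r d + h) d then (((Finset.range d).filter (fun ρ : ℕ => ∀ h ∈ H, Nat.Coprime (ρ + h) d)).card : ℝ)⁻¹ else 0) * ∑ n ∈ Finset.Icc 1 (y d), ∏ h ∈ H, ArithmeticFunction.vonMangoldt (n + h)|) ≤ C * N / Real.log N ^ B) := by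
  intro hS H _h0 hH δ hδ B
  have hk : 1 ≤ H.card := by omega
  have hpos : ∀ i : Fin H.card,
      0 < ((fun j : Fin H.card => (⟨fun _ => (1 : ℤ), ((H.equivFin.symm j : ℕ) : ℤ)⟩ : AffLinForm 1)) i).coeff 0 ∧
        0 ≤ ((fun j : Fin H.card => (⟨fun _ => (1 : ℤ), ((H.equivFin.symm j : ℕ) : ℤ)⟩ : AffLinForm 1)) i).const :=
    fun i => ⟨one_pos, Int.natCast_nonneg _⟩
  obtain ⟨C, hC⟩ := hS H.card hk _ (isNondegenerateSystem_translate H) hpos δ hδ B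
  refine ⟨C, fun N hN y r hy => ?_⟩
  have h := hC N hN y r hy
  simp only [eval_shiftForm, intVonMangoldt_natCast_add, int_gcd_natCast_add_eq_one_iff,
    prod_vonMangoldt_equivFin_symm, forall_coprime_equivFin_symm] at h
  exact h

/-- **`stub_slopedAtoms` (crux 9389) implies `stub_tupleAtoms` (crux 14995), statements verbatim.** Instantiate
at the translate system of `H` with the adjoined form `ψ(n) = n + h` (`h ∉ H`: the extended system
`vecCons ψ Φ` is the translate system of distinct shifts, hence non-degenerate); `λ(ψ(n).toNat) = λ(n + h)`.
[folklore] -/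
theorem stub_tupleAtomsOfSloped :
    (∀ t : ℕ, 1 ≤ t → ∀ (Φ : Fin t → Literature.NumberTheory.Sieve.AffLinForm 1) (ψ : Literature.NumberTheory.Sieve.AffLinForm 1), Literature.NumberTheory.Sieve.IsNondegenerateSystem (Matrix.vecCons ψ Φ) → (∀ i, 0 < (Φ i).coeff 0 ∧ 0 ≤ (Φ i).const) → (0 < ψ.coeff 0 ∧ 0 ≤ ψ.const) → (∃ ε₀ : ℝ, 0 < ε₀ ∧ ∀ A : ℝ, 0 < A → ∃ C : ℝ, ∃ N₀ : ℕ, ∀ N : ℕ, N₀ ≤ N → ∀ w y : ℕ → ℕ, (∀ q, y q ≤ N) → (∑ q ∈ Finset.Icc 1 ⌊(N : ℝ) ^ ε₀⌋₊, |∑ n ∈ (Finset.Icc 1 (y q)).filter (fun n : ℕ => n ≡ w q [MOD q]), (ArithmeticFunction.liouville (Int.toNat (ψ.eval ![(n : ℤ)])) : ℝ) * ∏ i, Literature.NumberTheory.Sieve.intVonMangoldt ((Φ i).eval ![(n : ℤ)])|) ≤ C * N / Real.log N ^ A)) →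
    ∀ (H : Finset ℕ) (h : ℕ), 0 ∈ H → 2 ≤ H.card → h ∉ H → (∃ ε₀ : ℝ, 0 < ε₀ ∧ ∀ A : ℝ, 0 < A → ∃ C : ℝ, ∃ N₀ : ℕ, ∀ N : ℕ, N₀ ≤ N → ∀ w y : ℕ → ℕ, (∀ q, y q ≤ N) → (∑ q ∈ Finset.Icc 1 ⌊(N : ℝ) ^ ε₀⌋₊, |∑ n ∈ (Finset.Icc 1 (y q)).filter (fun n : ℕ => n ≡ w q [MOD q]), (ArithmeticFunction.liouville (n + h) : ℝ) * ∏ h' ∈ H, ArithmeticFunction.vonMangoldt (n + h')|) ≤ C * N / Real.log N ^ A) := by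
  intro hS H h _h0 hH hh
  have hk : 1 ≤ H.card := by omega
  have hpos : ∀ i : Fin H.card,
      0 < ((fun j : Fin H.card => (⟨fun _ => (1 : ℤ), ((H.equivFin.symm j : ℕ) : ℤ)⟩ : AffLinForm 1)) i).coeff 0 ∧
        0 ≤ ((fun j : Fin H.card => (⟨fun _ => (1 : ℤ), ((H.equivFin.symm j : ℕ) : ℤ)⟩ : AffLinForm 1)) i).const :=
    fun i => ⟨one_pos, Int.natCast_nonneg _⟩
  have hψ : 0 < (⟨fun _ => (1 : ℤ), (h : ℤ)⟩ : AffLinForm 1).coeff 0 ∧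
      0 ≤ (⟨fun _ => (1 : ℤ), (h : ℤ)⟩ : AffLinForm 1).const :=
    ⟨one_pos, Int.natCast_nonneg _⟩
  obtain ⟨ε₀, hε₀, hA⟩ := hS H.card hk _ _ (isNondegenerateSystem_vecCons_translate H h hh) hpos hψ
  refine ⟨ε₀, hε₀, fun A hA0 => ?_⟩
  obtain ⟨C, N₀, hC⟩ := hA A hA0
  refine ⟨C, N₀, fun N hN w y hy => ?_⟩
  have h1 := hC N hN w y hy
  simp only [eval_shiftForm, intVonMangoldt_natCast_add, toNat_natCast_add,
    prod_vonMangoldt_equivFin_symm] at h1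
  exact h1

/-- Curried form of `stub_tupleLevelOfSloped`: the sloped relative level hypothesis (9389's `stub_slopedLevel`,
verbatim) gives the unit-slope one (14995's `stub_tupleLevel`, verbatim). [folklore] -/
theorem tupleLevel_of_slopedLevel
    (hS : ∀ t : ℕ, 1 ≤ t → ∀ Φ : Fin t → Literature.NumberTheory.Sieve.AffLinForm 1, Literature.NumberTheory.Sieve.IsNondegenerateSystem Φ → (∀ i, 0 < (Φ i).coeff 0 ∧ 0 ≤ (Φ i).const) → (∀ δ : ℝ, 0 < δ → ∀ B : ℝ, ∃ C : ℝ, ∀ N : ℕ, 2 ≤ N → ∀ y r : ℕ → ℕ, (∀ d, y d ≤ N) → (∑ d ∈ Finset.Icc 1 ⌊(N : ℝ) ^ (1 - δ)⌋₊, |(∑ n ∈ (Finset.Icc 1 (y d)).filter (fun n : ℕ => n ≡ r d [MOD d]), ∏ i, Literature.NumberTheory.Sieve.intVonMangoldt ((Φ i).eval ![(n : ℤ)])) - (if ∀ i, Int.gcd ((Φ i).eval ![(r d : ℤ)]) d = 1 then ((((Finset.range d).filter (fun ρ : ℕ => ∀ i, Int.gcd ((Φ i).eval ![(ρ : ℤ)])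 d = 1)).card : ℝ))⁻¹ else 0) * ∑ n ∈ Finset.Icc 1 (y d), ∏ i, Literature.NumberTheory.Sieve.intVonMangoldt ((Φ i).eval ![(n : ℤ)])|) ≤ C * N / Real.log N ^ B)) :
    ∀ H : Finset ℕ, 0 ∈ H → 2 ≤ H.card → (∀ δ : ℝ, 0 < δ → ∀ B : ℝ, ∃ C : ℝ, ∀ N : ℕ, 2 ≤ N → ∀ y r : ℕ → ℕ, (∀ d, y d ≤ N) → (∑ d ∈ Finset.Icc 1 ⌊(N : ℝ) ^ (1 - δ)⌋₊, |(∑ n ∈ (Finset.Icc 1 (y d)).filter (fun n : ℕ => n ≡ r d [MOD d]), ∏ h ∈ H, ArithmeticFunction.vonMangoldt (n + h)) - (if ∀ h ∈ H, Nat.Coprime (r d + h) d then (((Finset.range d).filter (fun ρ : ℕ => ∀ h ∈ H, Nat.Coprime (ρ + h) d)).card : ℝ)⁻¹ else 0) * ∑ n ∈ Finset.Icc 1 (y d), ∏ h ∈ H, ArithmeticFunction.vonMangoldt (n + h)|) ≤ C * N / Real.log N ^ B) :=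
  stub_tupleLevelOfSloped hS

/-- Curried form of `stub_tupleAtomsOfSloped`: the sloped one-Liouville-factor atom hypothesis (9389's
`stub_slopedAtoms`, verbatim) gives the unit-slope one (14995's `stub_tupleAtoms`, verbatim). [folklore] -/
theorem tupleAtoms_of_slopedAtoms
    (hS : ∀ t : ℕ, 1 ≤ t → ∀ (Φ : Fin t → Literature.NumberTheory.Sieve.AffLinForm 1) (ψ : Literature.NumberTheory.Sieve.AffLinForm 1), Literature.NumberTheory.Sieve.IsNondegenerateSystem (Matrix.vecCons ψ Φ) → (∀ i, 0 < (Φ i).coeff 0 ∧ 0 ≤ (Φ i).const) → (0 < ψ.coeff 0 ∧ 0 ≤ ψ.const) → (∃ ε₀ : ℝ, 0 < ε₀ ∧ ∀ A : ℝ, 0 < A → ∃ C : ℝ, ∃ N₀ : ℕ, ∀ N : ℕ, N₀ ≤ N → ∀ w y : ℕ → ℕ, (∀ q, y q ≤ N) → (∑ q ∈ Finset.Icc 1 ⌊(N : ℝ) ^ ε₀⌋₊, |∑ n ∈ (Finset.Icc 1 (y q)).filter (fun n : ℕ => n ≡ w q [MOD q]), (ArithmeticFunction.liouville (Int.toNat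 (ψ.eval ![(n : ℤ)])) : ℝ) * ∏ i, Literature.NumberTheory.Sieve.intVonMangoldt ((Φ i).eval ![(n : ℤ)])|) ≤ C * N / Real.log N ^ A)) :
    ∀ (H : Finset ℕ) (h : ℕ), 0 ∈ H → 2 ≤ H.card → h ∉ H → (∃ ε₀ : ℝ, 0 < ε₀ ∧ ∀ A : ℝ, 0 < A → ∃ C : ℝ, ∃ N₀ : ℕ, ∀ N : ℕ, N₀ ≤ N → ∀ w y : ℕ → ℕ, (∀ q, y q ≤ N) → (∑ q ∈ Finset.Icc 1 ⌊(N : ℝ) ^ ε₀⌋₊, |∑ n ∈ (Finset.Icc 1 (y q)).filter (fun n : ℕ => n ≡ w q [MOD q]), (ArithmeticFunction.liouville (n + h) : ℝ) * ∏ h' ∈ H, ArithmeticFunction.vonMangoldt (n + h')|) ≤ C * N / Real.log N ^ A) :=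
  stub_tupleAtomsOfSloped hS

/-! ### Consequences for the crux -/

/-- **`EngineToGHL` from the sloped inputs and this line's residual.** The two conjecture-grade inputs of the
sloped ladder (crux 9389: `stub_slopedLevel`, `stub_slopedAtoms`, verbatim) together with the residual
`Reach → DimOne` of line `tuple_ladder` give the crux, through `engineToGHL_of_reachInputs` (lead c5).
[folklore] -/
theorem engineToGHL_of_slopedInputs
    (h1 : ∀ t : ℕ, 1 ≤ t → ∀ Φ : Fin t → Literature.NumberTheory.Sieve.AffLinForm 1, Literature.NumberTheory.Sieve.IsNondegenerateSystem Φ → (∀ i, 0 < (Φ i).coeff 0 ∧ 0 ≤ (Φ i).const) → (∀ δ : ℝ, 0 < δ → ∀ B : ℝ, ∃ C : ℝ, ∀ N : ℕ, 2 ≤ N → ∀ y r : ℕ → ℕ, (∀ d, y d ≤ N) → (∑ d ∈ Finset.Icc 1 ⌊(N : ℝ) ^ (1 - δ)⌋₊, |(∑ n ∈ (Finset.Icc 1 (y d)).filter (fun n : ℕ => n ≡ r d [MOD d]), ∏ i, Literature.NumberTheory.Sieve.intVonMangoldt ((Φ i).eval ![(n : ℤ)])) - (if ∀ i, Int.gcd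 ((Φ i).eval ![(r d : ℤ)]) d = 1 then ((((Finset.range d).filter (fun ρ : ℕ => ∀ i, Int.gcd ((Φ i).eval ![(ρ : ℤ)]) d = 1)).card : ℝ))⁻¹ else 0) * ∑ n ∈ Finset.Icc 1 (y d), ∏ i, Literature.NumberTheory.Sieve.intVonMangoldt ((Φ i).eval ![(n : ℤ)])|) ≤ C * N / Real.log N ^ B))
    (h2 : ∀ t : ℕ, 1 ≤ t → ∀ (Φ : Fin t → Literature.NumberTheory.Sieve.AffLinForm 1) (ψ : Literature.NumberTheory.Sieve.AffLinForm 1), Literature.NumberTheory.Sieve.IsNondegenerateSystem (Matrix.vecCons ψ Φ) → (∀ i, 0 < (Φ i).coeff 0 ∧ 0 ≤ (Φ i).const) → (0 < ψ.coeff 0 ∧ 0 ≤ ψ.const) → (∃ ε₀ : ℝ, 0 < ε₀ ∧ ∀ A : ℝ, 0 < A → ∃ C : ℝ, ∃ N₀ : ℕ, ∀ N : ℕ, N₀ ≤ N → ∀ w y : ℕ → ℕ, (∀ q, y q ≤ N) → (∑ q ∈ Finset.Icc 1 ⌊(N : ℝ) ^ ε₀⌋₊, |∑ n ∈ (Finset.Icc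 1 (y q)).filter (fun n : ℕ => n ≡ w q [MOD q]), (ArithmeticFunction.liouville (Int.toNat (ψ.eval ![(n : ℤ)])) : ℝ) * ∏ i, Literature.NumberTheory.Sieve.intVonMangoldt ((Φ i).eval ![(n : ℤ)])|) ≤ C * N / Real.log N ^ A))
    (h3 : (∀ (t Hb L : ℕ) (ε : ℝ), 2 ≤ t → 0 < ε → ∃ N₀ : ℕ, ∀ N : ℕ, N₀ ≤ N → ∀ Ψ : Fin t → Literature.NumberTheory.Sieve.AffLinForm 1, Literature.NumberTheory.Sieve.IsNondegenerateSystem Ψ → Literature.NumberTheory.Sieve.affLinSize Ψ N ≤ L → (∀ i j, (Ψ i).coeff j = 1) → (∀ i j, |(Ψ i).const - (Ψ j).const| ≤ (Hb : ℤ)) → ∀ K : Set (Fin 1 → ℝ), Convex ℝ K → K ⊆ Literature.NumberTheory.Sieve.realBox 1 N → |Literature.NumberTheory.Sieve.vonMangoldtSum Ψ K N - Literature.NumberTheory.Sieve.archFactor Ψ K * Literature.NumberTheory.Sieve.singularProduct Ψ| ≤ ε * (N : ℝ)) → ∀ (t L : ℕ), 1 ≤ t → ∀ ε : ℝ, 0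 < ε → ∃ N₀ : ℕ, ∀ N : ℕ, N₀ ≤ N → ∀ Ψ : Fin t → Literature.NumberTheory.Sieve.AffLinForm 1, Literature.NumberTheory.Sieve.IsNondegenerateSystem Ψ → Literature.NumberTheory.Sieve.affLinSize Ψ N ≤ L → ∀ K : Set (Fin 1 → ℝ), Convex ℝ K → K ⊆ Literature.NumberTheory.Sieve.realBox 1 N → |Literature.NumberTheory.Sieve.vonMangoldtSum Ψ K N - Literature.NumberTheory.Sieve.archFactor Ψ K * Literature.NumberTheory.Sieve.singularProduct Ψ| ≤ ε * (N : ℝ)) :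
    Summit.Parity.GeneralizedHardyLittlewood.Theses.LiouvilleMAD.EngineToGHL :=
  engineToGHL_of_reachInputs (tupleLevel_of_slopedLevel h1) (tupleAtoms_of_slopedAtoms h2) h3

/-- **`EngineToGHL` from the sloped ladder's output and residual.** `BoundedDickson` (stmt-Parity-13151, the text
of the conclusion of `stub_toBounded` on crux 9389) and the shift lift `BoundedDickson → DimOne` (the text of
`stub_shiftLift`) give `DimOne` (stmt-Parity-0819) and hence the crux (`engineToGHL_of_dimOne`). [folklore] -/
theorem engineToGHL_of_boundedDickson_of_shiftLift
    (hB : ∀ (t : ℕ) (Φ : Fin t → Literature.NumberTheory.Sieve.AffLinForm 1), 1 ≤ t → Literature.NumberTheory.Sieve.IsNondegenerateSystem Φ → ∀ ε : ℝ, 0 < ε → ∃ N₀ : ℕ, ∀ N : ℕ, N₀ ≤ N → ∀ K : Set (Fin 1 → ℝ), Convex ℝ K → K ⊆ Literature.NumberTheory.Sieve.realBox 1 N → |Literature.NumberTheory.Sieve.vonMangoldtSum Φ K N - Literature.NumberTheory.Sieve.archFactor Φ K * Literature.NumberTheory.Sieve.singularProduct Φ| ≤ ε * N)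
    (hLift : (∀ (t : ℕ) (Φ : Fin t → Literature.NumberTheory.Sieve.AffLinForm 1), 1 ≤ t → Literature.NumberTheory.Sieve.IsNondegenerateSystem Φ → ∀ ε : ℝ, 0 < ε → ∃ N₀ : ℕ, ∀ N : ℕ, N₀ ≤ N → ∀ K : Set (Fin 1 → ℝ), Convex ℝ K → K ⊆ Literature.NumberTheory.Sieve.realBox 1 N → |Literature.NumberTheory.Sieve.vonMangoldtSum Φ K N - Literature.NumberTheory.Sieve.archFactor Φ K * Literature.NumberTheory.Sieve.singularProduct Φ| ≤ ε * N) →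
      ∀ (t L : ℕ), 1 ≤ t → ∀ ε : ℝ, 0 < ε → ∃ N₀ : ℕ, ∀ N : ℕ, N₀ ≤ N → ∀ Ψ : Fin t → Literature.NumberTheory.Sieve.AffLinForm 1, Literature.NumberTheory.Sieve.IsNondegenerateSystem Ψ → Literature.NumberTheory.Sieve.affLinSize Ψ N ≤ L → ∀ K : Set (Fin 1 → ℝ), Convex ℝ K → K ⊆ Literature.NumberTheory.Sieve.realBox 1 N → |Literature.NumberTheory.Sieve.vonMangoldtSum Ψ K N - Literature.NumberTheory.Sieve.archFactor Ψ K * Literature.NumberTheory.Sieve.singularProduct Ψ| ≤ ε * (N : ℝ)) :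
    Summit.Parity.GeneralizedHardyLittlewood.Theses.LiouvilleMAD.EngineToGHL :=
  engineToGHL_of_dimOne (hLift hB)

end Summit.Parity.GeneralizedHardyLittlewood.Theorems.EngineToGHL.SlopedInputs
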